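import Summits.ABC.IUTFork.LDHGenuinePerImageSufficiencyRamifiedRat
import HarnessLib

/-!
# The fork at [IUTchIII] Corollary 3.12, L-DH level, READING (P): the REYSSAT datum `2 + 3¹⁰·109 = 23⁵` at `l = 13, 17, 19` — the
# per-image Corollary HOLDS at every genuine Θ-datum whose `K` is ramified with index `≥ l − 1` over `l` (⇐ `μ_l ⊆ K`, GAP G-c312d1g8-1)
# (abc-iut cell; R-W critical rows «Reyssat @ 13/17/19» of C-R39 (5); crux ThetaPartII = stmt-ABC-19678, stub `stub_cor312PerImage`)

Record-only PROOF file (D-0012) of the abc-iut cell (WAVE-3 discharge seat abc-iut-c312-d1, gen 8), the template of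
`LDHGenuinePerImageFrey1061Thirteen.lean` (p469806) run on the highest-quality known abc triple. TAKES NO SIDE on [IUTchIII] Cor. 3.12.
Frey–Legendre point `λ = a/c = 2/23⁵ = 2/6436343`, `j(λ) = 2⁶(a² − ac + c²)³/(3²⁰·23¹⁰·109²)` (the denominator is ODD: `2 ∉ I`), so for EVERY
prime `l ∉ {3, 23, 109}`: `log q^{∤2l}(λ) = 20 log 3 + 10 log 23 + 2 log 109` (= 62.71) and `log 𝔣^{∤2l}(λ) = log 3 + log 23 + log 109` (= 8.93)
(`Cor22.logQAvoid_reyssat`, `Cor22.logCondAvoid_reyssat`, by the dictionary p462751). The rows `l = 13, 17, 19` are SZPIRO-BAD (margins −0.33,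
−1.51, −1.81) and WINDOW (no engine decides `S_H`). HERE, for each of the three levels: the arithmetic heart (`reyssat_key_ineq_<l>`: ONE inequality
of natural numbers by `decide`, `π > 3`; margins 7.8 / 10.6 / 12.2 nats) and **`Cor22.cor312PerImageOf_reyssat_<l>` : for every genuine Θ-volume
datum `T` of `(λ, l)` whose `K` has ramification index `≥ l − 1` over `l`, `T.Cor312PerImageOf`** (by `cor312PerImageOf_ratPoint_of_ramified_over_l`,
p470192). The ramification hypothesis is EXPLICIT (consequence of `μ_l ⊆ K ⊇ F(E_F[l])`, Weil pairing — NOT in the tree: GAP-LEDGER G-c312d1g8-1).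
Nothing here asserts the existence of data at `(λ, l)`, Cor. 3.12 in general, or abc; proved-as-typed ≠ in print. [cite: Mochizuki2012, IUTchIII
Cor. 3.12 p. 173–174; IUTchIV Thm. 1.10 Step (ii) p. 24, (v) p. 27–29, Cor. 2.2 (ii) proof p. 44–46] [cite: MochizukiGenEll2010, Def. 3.3 p. 12]
[claim: Mochizuki2012, status: disputed] for every IUT quotation. PROOF-ONLY: no definitions.
-/

noncomputable section

namespace Literature.IUT.LogVolume.Cor22

open NumberField IsDedekindDomain Ideal Module Literature.NumberTheory.DiophantineGeometry
open Literature.NumberTheory.DiophantineGeometry.GenEll Summit.ABC.IUTFork Literature.IUT.HodgeTheaters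

/-! ## 1. The certificate data of the Reyssat point `λ = 2/23⁵` -/

/-- The primes of the reduced denominator of `j(λ)`. [folklore] -/
private theorem reyssat_primes : ∀ p ∈ ({3, 23, 109} : Finset ℕ), p.Prime := by
  intro p hp
  simp only [Finset.mem_insert, Finset.mem_singleton] at hp
  rcases hp with rfl | rfl | rfl <;> norm_num

/-- The exponents are positive. [folklore] -/
private theorem reyssat_exp_ne_zero :
    ∀ p ∈ ({3, 23, 109} : Finset ℕ), (fun p => if p = 3 then 20 else if p = 23 then 10 else 2) p ≠ 0 := by
  intro p hp
  simp only [Finset.mem_insert, Finset.mem_singleton] at hp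
  rcases hp with rfl | rfl | rfl <;> norm_num

/-- The factorised denominator `3²⁰·23¹⁰·109²`. [folklore] -/
private theorem reyssat_den :
    (1716154764793810191403767369 : ℕ) = ∏ p ∈ ({3, 23, 109} : Finset ℕ), p ^ (fun p => if p = 3 then 20 else if p = 23 then 10 else 2) p := by
  rw [Finset.prod_insert (by decide), Finset.prod_insert (by decide), Finset.prod_singleton]
  norm_num

/-- `j(2/23⁵) = 2⁶(a² − ac + c²)³/(3²⁰·23¹⁰·109²)` as a reduced fraction of naturals. [cite: SilvermanAEC2009, Prop. III.1.7(b)] -/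
theorem jInv_reyssat : jInv ((2 : ℚ) / 6436343) = ((4550034081061575630856781958829776704708032 : ℕ) : ℚ) / ((1716154764793810191403767369 : ℕ) : ℚ) := by
  norm_num [jInv]

/-- The numerator is prime to `3, 23, 109`. [folklore] -/
private theorem reyssat_coprime : ∀ p ∈ ({3, 23, 109} : Finset ℕ), ¬ p ∣ (4550034081061575630856781958829776704708032 : ℕ) := by
  intro p hp
  simp only [Finset.mem_insert, Finset.mem_singleton] at hp
  rcases hp with rfl | rfl | rfl <;> norm_num

/-! ## 2. Exact `log q^{∤2l}` and `log 𝔣^{∤2l}` at every prime `l ∉ {3, 23, 109}` -/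

/-- **`log q^{∤2l}(2/23⁵) = 20 log 3 + 10 log 23 + 2 log 109`** for every prime `l ∉ {3, 23, 109}`.
[cite: Mochizuki2012, IUTchIV Thm 1.10 p.23] [claim: Mochizuki2012, status: disputed] -/
theorem logQAvoid_reyssat {l : ℕ} (hl : l.Prime) (hl3 : l ≠ 3) (hl23 : l ≠ 23) (hl109 : l ≠ 109) :
    logQAvoid (ratPoint ((2 : ℚ) / 6436343)) {2, l} = 20 * Real.log 3 + 10 * Real.log 23 + 2 * Real.log 109 := by
  have hnot : l ∉ ({3, 23, 109} : Finset ℕ) := by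
    simp only [Finset.mem_insert, Finset.mem_singleton, not_or]; exact ⟨hl3, hl23, hl109⟩
  rw [logQAvoid_ratPoint_two_prime_eq_sum reyssat_primes reyssat_exp_ne_zero reyssat_den jInv_reyssat (by norm_num)
    reyssat_coprime (by decide) hl, Finset.erase_eq_of_notMem hnot,
    Finset.sum_insert (by decide), Finset.sum_insert (by decide), Finset.sum_singleton]
  norm_num
  ring

/-- **`log 𝔣^{∤2l}(2/23⁵) = log 3 + log 23 + log 109`** for every prime `l ∉ {3, 23, 109}`.
[cite: Mochizuki2012, IUTchIV Thm 1.10 p.23] [claim: Mochizuki2012, status: disputed] -/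
theorem logCondAvoid_reyssat {l : ℕ} (hl : l.Prime) (hl3 : l ≠ 3) (hl23 : l ≠ 23) (hl109 : l ≠ 109) :
    logCondAvoid (ratPoint ((2 : ℚ) / 6436343)) {2, l} = Real.log 3 + Real.log 23 + Real.log 109 := by
  have hnot : l ∉ ({3, 23, 109} : Finset ℕ) := by
    simp only [Finset.mem_insert, Finset.mem_singleton, not_or]; exact ⟨hl3, hl23, hl109⟩
  rw [logCondAvoid_ratPoint_two_prime_eq_sum reyssat_primes reyssat_exp_ne_zero reyssat_den jInv_reyssat (by norm_num)
    reyssat_coprime (by decide) hl, Finset.erase_eq_of_notMem hnot,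
    Finset.sum_insert (by decide), Finset.sum_insert (by decide), Finset.sum_singleton]
  norm_num
  ring

/-! ## 3. The three levels -/

set_option exponentiation.threshold 10000 in
/-- The integer certificate at `l = 13` (`π > 3`): `3 ^ 988 * 23 ^ 692 ≤ 109 ^ 668 * 13 ^ 1001`. [folklore] -/
private theorem reyssat_nat_ineq_thirteen : (3 ^ 988 * 23 ^ 692 : ℕ) ≤ 109 ^ 668 * 13 ^ 1001 := by
  decide

/-- **The arithmetic heart at `l = 13`**: `κ_13·log q^{∤2l} ≤ ((13+5)/4 − 1)·((1 − 1/13)·log 𝔣^{∤2l} + (1 − 1/12)·log 13) + ((13+5)/4)·log π`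
at the Reyssat point (×L an inequality of naturals, `reyssat_nat_ineq_thirteen`, plus `π > 3`). [folklore] -/
theorem reyssat_key_ineq_thirteen :
    (85 / 156 : ℝ) * (20 * Real.log 3 + 10 * Real.log 23 + 2 * Real.log 109) ≤
      (7 / 2 : ℝ) * ((12 / 13 : ℝ) * (Real.log 3 + Real.log 23 + Real.log 109) + (11 / 12 : ℝ) * Real.log 13)
        + (9 / 2 : ℝ) * Real.log Real.pi := by
  have hZ := reyssat_nat_ineq_thirteen
  have hR : (((3 : ℝ) ^ 988 * (23 : ℝ) ^ 692) : ℝ) ≤ ((109 : ℝ) ^ 668 * (13 : ℝ) ^ 1001) := by exact_mod_cast hZ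
  have hpos : (0 : ℝ) < ((3 : ℝ) ^ 988 * (23 : ℝ) ^ 692) := by positivity
  have hlog := Real.log_le_log hpos hR
  rw [Real.log_mul (by positivity) (by positivity), Real.log_pow, Real.log_pow] at hlog
  rw [Real.log_mul (by positivity) (by positivity), Real.log_pow, Real.log_pow] at hlog
  have hpi : Real.log 3 < Real.log Real.pi := Real.log_lt_log (by norm_num) Real.pi_gt_three
  have h3 : 0 < Real.log 3 := Real.log_pos (by norm_num)
  have h23 : 0 < Real.log 23 := Real.log_pos (by norm_num)
  have h109 : 0 < Real.log 109 := Real.log_pos (by norm_num)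
  push_cast at hlog
  linarith [hlog, hpi]

/-- **[IUTchIII] COR. 3.12 IN READING (P), AS TYPED, AT EVERY GENUINE Θ-DATUM OF THE REYSSAT ROW `(2/23⁵, 13)` WHOSE `K` IS RAMIFIED WITH
INDEX `≥ 12` OVER `13`** (⇐ `μ_13 ⊆ K`, GAP-LEDGER G-c312d1g8-1): `T.Cor312PerImageOf`. [cite: Mochizuki2012, IUTchIII Cor. 3.12 p. 173–174]
[cite: Mochizuki2012, IUTchIV Thm. 1.10 Step (ii) p. 24, Step (v) p. 27–29] [claim: Mochizuki2012, status: disputed] -/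
theorem cor312PerImageOf_reyssat_thirteen (T : ThetaVolumeDatumAt (ratPoint ((2 : ℚ) / 6436343)) 13)
    (hram : letI := T.instFieldF; letI := T.instNumberFieldF; letI := T.instAlgebraF; letI := T.instFieldK
      letI := T.instNumberFieldK; letI := T.instAlgebraK
      letI : Algebra (ratPoint ((2 : ℚ) / 6436343)).F T.K :=
        ((algebraMap T.F T.K).comp (algebraMap (ratPoint ((2 : ℚ) / 6436343)).F T.F)).toAlgebra
      ∀ v : HeightOneSpectrum (𝓞 (ratPoint ((2 : ℚ) / 6436343)).F), ((13 : ℕ) : 𝓞 (ratPoint ((2 : ℚ) / 6436343)).F) ∈ v.asIdeal →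
        ∀ w ∈ IsDedekindDomain.primesOverFinset v.asIdeal (𝓞 T.K), 12 ≤ ramificationIdx' v.asIdeal w) :
    T.Cor312PerImageOf := by
  refine cor312PerImageOf_ratPoint_of_ramified_over_l (q := (2 : ℚ) / 6436343) (by norm_num) (by norm_num) (by norm_num)
    (by norm_num) (m := 12) (by norm_num) ?_ T hram
  rw [logQAvoid_reyssat (by norm_num) (by norm_num) (by norm_num) (by norm_num),
    logCondAvoid_reyssat (by norm_num) (by norm_num) (by norm_num) (by norm_num)]
  have hkey := reyssat_key_ineq_thirteen
  norm_num at hkey ⊢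
  linarith [hkey]

set_option exponentiation.threshold 10000 in
/-- The integer certificate at `l = 17` (`π > 3`): `3 ^ 2544 * 23 ^ 1616 ≤ 109 ^ 1520 * 17 ^ 2295`. [folklore] -/
private theorem reyssat_nat_ineq_seventeen : (3 ^ 2544 * 23 ^ 1616 : ℕ) ≤ 109 ^ 1520 * 17 ^ 2295 := by
  decide

/-- **The arithmetic heart at `l = 17`**: `κ_17·log q^{∤2l} ≤ ((17+5)/4 − 1)·((1 − 1/17)·log 𝔣^{∤2l} + (1 − 1/16)·log 17) + ((17+5)/4)·log π`
at the Reyssat point (×L an inequality of naturals, `reyssat_nat_ineq_seventeen`, plus `π > 3`). [folklore] -/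
theorem reyssat_key_ineq_seventeen :
    (49 / 68 : ℝ) * (20 * Real.log 3 + 10 * Real.log 23 + 2 * Real.log 109) ≤
      (9 / 2 : ℝ) * ((16 / 17 : ℝ) * (Real.log 3 + Real.log 23 + Real.log 109) + (15 / 16 : ℝ) * Real.log 17)
        + (11 / 2 : ℝ) * Real.log Real.pi := by
  have hZ := reyssat_nat_ineq_seventeen
  have hR : (((3 : ℝ) ^ 2544 * (23 : ℝ) ^ 1616) : ℝ) ≤ ((109 : ℝ) ^ 1520 * (17 : ℝ) ^ 2295) := by exact_mod_cast hZ
  have hpos : (0 : ℝ) < ((3 : ℝ) ^ 2544 * (23 : ℝ) ^ 1616) := by positivity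
  have hlog := Real.log_le_log hpos hR
  rw [Real.log_mul (by positivity) (by positivity), Real.log_pow, Real.log_pow] at hlog
  rw [Real.log_mul (by positivity) (by positivity), Real.log_pow, Real.log_pow] at hlog
  have hpi : Real.log 3 < Real.log Real.pi := Real.log_lt_log (by norm_num) Real.pi_gt_three
  have h3 : 0 < Real.log 3 := Real.log_pos (by norm_num)
  have h23 : 0 < Real.log 23 := Real.log_pos (by norm_num)
  have h109 : 0 < Real.log 109 := Real.log_pos (by norm_num)
  push_cast at hlog
  linarith [hlog, hpi]

/-- **[IUTchIII] COR. 3.12 IN READING (P), AS TYPED, AT EVERY GENUINE Θ-DATUM OF THE REYSSAT ROW `(2/23⁵, 17)` WHOSE `K` IS RAMIFIED WITH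
INDEX `≥ 16` OVER `17`** (⇐ `μ_17 ⊆ K`, GAP-LEDGER G-c312d1g8-1): `T.Cor312PerImageOf`. [cite: Mochizuki2012, IUTchIII Cor. 3.12 p. 173–174]
[cite: Mochizuki2012, IUTchIV Thm. 1.10 Step (ii) p. 24, Step (v) p. 27–29] [claim: Mochizuki2012, status: disputed] -/
theorem cor312PerImageOf_reyssat_seventeen (T : ThetaVolumeDatumAt (ratPoint ((2 : ℚ) / 6436343)) 17)
    (hram : letI := T.instFieldF; letI := T.instNumberFieldF; letI := T.instAlgebraF; letI := T.instFieldK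
      letI := T.instNumberFieldK; letI := T.instAlgebraK
      letI : Algebra (ratPoint ((2 : ℚ) / 6436343)).F T.K :=
        ((algebraMap T.F T.K).comp (algebraMap (ratPoint ((2 : ℚ) / 6436343)).F T.F)).toAlgebra
      ∀ v : HeightOneSpectrum (𝓞 (ratPoint ((2 : ℚ) / 6436343)).F), ((17 : ℕ) : 𝓞 (ratPoint ((2 : ℚ) / 6436343)).F) ∈ v.asIdeal →
        ∀ w ∈ IsDedekindDomain.primesOverFinset v.asIdeal (𝓞 T.K), 16 ≤ ramificationIdx' v.asIdeal w) :
    T.Cor312PerImageOf := by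
  refine cor312PerImageOf_ratPoint_of_ramified_over_l (q := (2 : ℚ) / 6436343) (by norm_num) (by norm_num) (by norm_num)
    (by norm_num) (m := 16) (by norm_num) ?_ T hram
  rw [logQAvoid_reyssat (by norm_num) (by norm_num) (by norm_num) (by norm_num),
    logCondAvoid_reyssat (by norm_num) (by norm_num) (by norm_num) (by norm_num)]
  have hkey := reyssat_key_ineq_seventeen
  norm_num at hkey ⊢
  linarith [hkey]

set_option exponentiation.threshold 10000 in
/-- The integer certificate at `l = 19` (`π > 3`): `3 ^ 1848 * 23 ^ 1140 ≤ 109 ^ 1068 * 19 ^ 1615`. [folklore] -/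
private theorem reyssat_nat_ineq_nineteen : (3 ^ 1848 * 23 ^ 1140 : ℕ) ≤ 109 ^ 1068 * 19 ^ 1615 := by
  decide

/-- **The arithmetic heart at `l = 19`**: `κ_19·log q^{∤2l} ≤ ((19+5)/4 − 1)·((1 − 1/19)·log 𝔣^{∤2l} + (1 − 1/18)·log 19) + ((19+5)/4)·log π`
at the Reyssat point (×L an inequality of naturals, `reyssat_nat_ineq_nineteen`, plus `π > 3`). [folklore] -/
theorem reyssat_key_ineq_nineteen :
    (46 / 57 : ℝ) * (20 * Real.log 3 + 10 * Real.log 23 + 2 * Real.log 109) ≤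
      (5 : ℝ) * ((18 / 19 : ℝ) * (Real.log 3 + Real.log 23 + Real.log 109) + (17 / 18 : ℝ) * Real.log 19)
        + (6 : ℝ) * Real.log Real.pi := by
  have hZ := reyssat_nat_ineq_nineteen
  have hR : (((3 : ℝ) ^ 1848 * (23 : ℝ) ^ 1140) : ℝ) ≤ ((109 : ℝ) ^ 1068 * (19 : ℝ) ^ 1615) := by exact_mod_cast hZ
  have hpos : (0 : ℝ) < ((3 : ℝ) ^ 1848 * (23 : ℝ) ^ 1140) := by positivity
  have hlog := Real.log_le_log hpos hR
  rw [Real.log_mul (by positivity) (by positivity), Real.log_pow, Real.log_pow] at hlog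
  rw [Real.log_mul (by positivity) (by positivity), Real.log_pow, Real.log_pow] at hlog
  have hpi : Real.log 3 < Real.log Real.pi := Real.log_lt_log (by norm_num) Real.pi_gt_three
  have h3 : 0 < Real.log 3 := Real.log_pos (by norm_num)
  have h23 : 0 < Real.log 23 := Real.log_pos (by norm_num)
  have h109 : 0 < Real.log 109 := Real.log_pos (by norm_num)
  push_cast at hlog
  linarith [hlog, hpi]

/-- **[IUTchIII] COR. 3.12 IN READING (P), AS TYPED, AT EVERY GENUINE Θ-DATUM OF THE REYSSAT ROW `(2/23⁵, 19)` WHOSE `K` IS RAMIFIED WITH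
INDEX `≥ 18` OVER `19`** (⇐ `μ_19 ⊆ K`, GAP-LEDGER G-c312d1g8-1): `T.Cor312PerImageOf`. [cite: Mochizuki2012, IUTchIII Cor. 3.12 p. 173–174]
[cite: Mochizuki2012, IUTchIV Thm. 1.10 Step (ii) p. 24, Step (v) p. 27–29] [claim: Mochizuki2012, status: disputed] -/
theorem cor312PerImageOf_reyssat_nineteen (T : ThetaVolumeDatumAt (ratPoint ((2 : ℚ) / 6436343)) 19)
    (hram : letI := T.instFieldF; letI := T.instNumberFieldF; letI := T.instAlgebraF; letI := T.instFieldK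
      letI := T.instNumberFieldK; letI := T.instAlgebraK
      letI : Algebra (ratPoint ((2 : ℚ) / 6436343)).F T.K :=
        ((algebraMap T.F T.K).comp (algebraMap (ratPoint ((2 : ℚ) / 6436343)).F T.F)).toAlgebra
      ∀ v : HeightOneSpectrum (𝓞 (ratPoint ((2 : ℚ) / 6436343)).F), ((19 : ℕ) : 𝓞 (ratPoint ((2 : ℚ) / 6436343)).F) ∈ v.asIdeal →
        ∀ w ∈ IsDedekindDomain.primesOverFinset v.asIdeal (𝓞 T.K), 18 ≤ ramificationIdx' v.asIdeal w) :
    T.Cor312PerImageOf := by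
  refine cor312PerImageOf_ratPoint_of_ramified_over_l (q := (2 : ℚ) / 6436343) (by norm_num) (by norm_num) (by norm_num)
    (by norm_num) (m := 18) (by norm_num) ?_ T hram
  rw [logQAvoid_reyssat (by norm_num) (by norm_num) (by norm_num) (by norm_num),
    logCondAvoid_reyssat (by norm_num) (by norm_num) (by norm_num) (by norm_num)]
  have hkey := reyssat_key_ineq_nineteen
  norm_num at hkey ⊢
  linarith [hkey]

end Literature.IUT.LogVolume.Cor22

end
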